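import Mathlib
import Summits.NavierStokesRegularity.NavierStokesRegularity.Theorems.TaoLadderRungTwoFlatTruncatedHopTwoGauge
import Summits.NavierStokesRegularity.NavierStokesRegularity.Theorems.TaoLadderRungTwoFlatAnchoredContractionDefs
import HarnessLib

/-!
# The localised hop estimate with the ANCHORED one-hop contraction (L5a of LADDER §51; junk race L8b-3 in the shape the
  hop invariant consumes) (helper for stmt-NavierStokesRegularity-23909 `GradedAdiabaticWake` / stmt-…-23908; route
  TaoLadderRungTwoFlat; cell harvest/h2-tao-ladder, p1 g21; theory-1 g39 TRAP #5 / repair R2)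

`MirrorPulse.truncated_hop_estimate₂` inherits the `∃ c₁ c₂` shape of `HopContractionWith` (correct, but lossy for the
one-hop ANCHORED frame: re-anchoring the certificate's `c₂` costs a factor `1+q` on everything). With theory-1 g39's
`MirrorPulse.AnchoredHopContraction ε τ Φ ω i₀ ρ C` (scale coefficient FORCED by the anchor coordinate) as the hypothesis the
loss falls on the REMAINDER only:

* `truncated_hop_estimate_anchored` — `Φ`, `X` global solutions of `T♭(ε)` bounded by `M`, `ω = geomGauge g b`, edge `e`,
  `η = truncFam e (X − Φ)`, core data `ω|η(0)| ≤ B`, `headGauge|η(0)| ≤ B′`, interface forcing `≤ F` (head gauge) and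
  `≤ Fω` (in `ω`) on `[0,τ]`, profile bound `ω_{ik}|Φ_{i,k+1}(τ)| ≤ q·ω_{i₀0}|Φ_{i₀1}(τ)|` off the anchor: there is a phase
  coefficient `c₁` (`|c₁| ≤ CB`) with
  `ω_{i,k}|η_{i,k+1}(τ) − c₁Φ̇_{i,k+1}(τ) − ĉ₂·Φ_{i,k+1}(τ)| ≤ ρB + (1+q)·Rem`,  `ĉ₂ = anchorCoeff ε τ Φ i₀ η c₁`
  (the corrected deviation VANISHES at the anchor coordinate), `Rem = (‖T♭‖₁g·R² + Fω)·τ·e^{2‖T♭‖₁M(max g b)τ}`,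
  `R = (B′ + Fτ)e^{2‖T♭‖₁Mgτ}` — the CORE-zone norms and the interface input only.

HONEST FRAMING: a conditional estimate about a MODEL lattice (Tao 2016 §4 vocabulary on `S♭`); the pulse, the anchored
(S2) and all bounds are HYPOTHESES; nothing certified; nothing about the Navier–Stokes equations.
-/

noncomputable section

-- the sub-problem namespace repeats the summit name by design (D-0017)
set_option linter.dupNamespace false

namespace Summit.NavierStokesRegularity.NavierStokesRegularity.Theorems

open Set Filter Literature.Analysis.FluidPDE Literature.Analysis.FluidPDE.TaoCascade QuadPolar
open scoped Topology

namespace MirrorPulse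

/-- The anchor coefficient is affine in the family: re-anchoring from `v` to `η` shifts it by `(η − v)_{i₀,1}(τ)/Φ_{i₀,1}(τ)`.
[cite: Tao2016AveragedNS, §6.3–6.4 (statement shape); cell LADDER §51] -/
theorem anchorCoeff_sub (ε τ : ℝ) (Φ : Fin 2 → ℤ → ℝ → ℝ) (i₀ : Fin 2) (η v : Fin 2 → ℤ → ℝ → ℝ) (c₁ : ℝ) :
    anchorCoeff ε τ Φ i₀ η c₁ - anchorCoeff ε τ Φ i₀ v c₁ = (η i₀ 1 τ - v i₀ 1 τ) / Φ i₀ 1 τ := by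
  unfold anchorCoeff
  ring

/-- **THE LOCALISED HOP ESTIMATE, ANCHORED (L5a).** See the module docstring.
[cite: Tao2016AveragedNS, §4 (4.8) and §6.3–6.4 (statement shape); route TaoLadderRungTwoFlat, transfer lemma L8b-3 / L5a (LADDER §49.5, §51)] -/
theorem truncated_hop_estimate_anchored {ε τ : ℝ} {Φ X : Fin 2 → ℤ → ℝ → ℝ} {g b ρ C M B B' F Fω q : ℝ} {e : ℤ}
    {i₀ : Fin 2} (hΦ : IsGlobalSol ε Φ) (hX : IsGlobalSol ε X) (hτ : 0 ≤ τ)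
    (hΦb : ∀ i n t, |Φ i n t| ≤ M) (hXb : ∀ i n t, |X i n t| ≤ M) (hg : 1 ≤ g) (hb : 1 ≤ b)
    (hS2 : AnchoredHopContraction ε τ Φ (geomGauge g b) i₀ ρ C) (hq : 0 ≤ q)
    (hprof : ∀ (i : Fin 2) (k : ℤ), ¬(i = i₀ ∧ k = 0) →
      geomGauge g b i k * |Φ i (k + 1) τ| ≤ q * (geomGauge g b i₀ 0 * |Φ i₀ 1 τ|))
    (hB : ∀ i k, geomGauge g b i k * |truncFam e (X - Φ) i k 0| ≤ B)
    (hB' : ∀ i k, headGauge g i k * |truncFam e (X - Φ) i k 0| ≤ B') (hF : 0 ≤ F)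
    (hfb : ∀ j k, ∀ t ∈ Icc 0 τ, headGauge g j k * |interfaceForcing ε 0 e Φ (X - Φ) j k t| ≤ F) (hFω : 0 ≤ Fω)
    (hfω : ∀ j k, ∀ t ∈ Icc 0 τ, geomGauge g b j k * |interfaceForcing ε 0 e Φ (X - Φ) j k t| ≤ Fω) :
    ∃ c₁ : ℝ, |c₁| ≤ C * B ∧
      ∀ (i : Fin 2) (k : ℤ), geomGauge g b i k *
          |truncFam e (X - Φ) i (k + 1) τ
            - c₁ * quadTermOn shiftSetFlat 0 (mirrorTable ε ε) Φ i (k + 1) τ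
            - anchorCoeff ε τ Φ i₀ (truncFam e (X - Φ)) c₁ * Φ i (k + 1) τ| ≤
        ρ * B + (1 + q) * ((tableAbsSum shiftSetFlat (mirrorTable ε ε) * g *
            ((B' + F * τ) * Real.exp (2 * tableAbsSum shiftSetFlat (mirrorTable ε ε) * M * g * τ)) ^ 2 + Fω) * τ *
              Real.exp (2 * tableAbsSum shiftSetFlat (mirrorTable ε ε) * M * max g b * τ)) := by
  obtain ⟨hωpos, hρ0, -, -, hΦa, hbody⟩ := hS2
  set u : Fin 2 → ℤ → ℝ → ℝ := X - Φ with hu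
  set η : Fin 2 → ℤ → ℝ → ℝ := truncFam e u with hηdef
  set Rem : ℝ := (tableAbsSum shiftSetFlat (mirrorTable ε ε) * g *
      ((B' + F * τ) * Real.exp (2 * tableAbsSum shiftSetFlat (mirrorTable ε ε) * M * g * τ)) ^ 2 + Fω) * τ *
        Real.exp (2 * tableAbsSum shiftSetFlat (mirrorTable ε ε) * M * max g b * τ) with hRem
  have hΦu : Φ + u = X := by rw [hu]; abel
  have hw : IsWindowRegular (headGauge g) g := isWindowRegular_headGauge hg
  have hA : IsWindowAdmissible (headGauge g) g := isWindowAdmissible_headGauge hg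
  have hω : IsWindowRegular (geomGauge g b) (max g b) := isWindowRegular_geomGauge hg hb
  have hωw : ∀ i k, geomGauge g b i k ≤ headGauge g i k := fun i k =>
    geomGauge_le_headGauge (by linarith) hb i k
  have hΦc : ∀ i k, Continuous (Φ i k) := fun i k => hΦ.continuous i k
  have huc : ∀ i k, Continuous (u i k) := fun i k => by
    have h : Continuous fun t => X i k t - Φ i k t := (hX.continuous i k).sub (hΦ.continuous i k)
    exact h
  have hηc : ∀ j k, Continuous (η j k) := continuous_truncFam huc
  have hXb' : ∀ i k t, |(Φ + u) i k t| ≤ M := by rw [hΦu]; exact hXb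
  have hXηb : ∀ i k t, |(Φ + η) i k t| ≤ M := abs_add_truncFam_le hΦb hXb'
  have hfc : ∀ j k, Continuous (interfaceForcing ε 0 e Φ u j k) := continuous_interfaceForcing hΦc huc
  have hηd : ∀ i n t, HasDerivAt (η i n)
      (quadTermOn shiftSetFlat 0 (mirrorTable ε ε) (Φ + η) i n t
        - quadTermOn shiftSetFlat 0 (mirrorTable ε ε) Φ i n t + interfaceForcing ε 0 e Φ u i n t) t := by
    intro i n t
    refine hasDerivAt_truncFam (fun j k => hΦ j k t) (fun j k => ?_) i n
    rw [hΦu]; exact hX j k t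
  -- the variational solution v along Φ from η(0)
  have hM0 : 0 ≤ max M 0 := le_max_right _ _
  have hWb' : ∀ j k t, |Φ j k t| ≤ max M 0 := fun j k t => (hΦb j k t).trans (le_max_left _ _)
  have hlipW : ∀ j k t s, |Φ j k t - Φ j k s| ≤ tableAbsSum shiftSetFlat (mirrorTable ε ε) * (max M 0) ^ 2 * |t - s| :=
    lipschitz_time_of_globalSol shiftSetFlat (mirrorTable ε ε) hΦ hWb'
  have hΛt : 0 ≤ tableAbsSum shiftSetFlat (mirrorTable ε ε) * (max M 0) ^ 2 := by
    have := tableAbsSum_nonneg shiftSetFlat (mirrorTable ε ε); positivity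
  have hd0 : ∀ i k, |(fun i k => η i k 0) i k| ≤ 2 * max M 0 := by
    intro i k
    have h1 := hXηb i k 0
    have h2 := hΦb i k 0
    have h3 := le_max_left M 0
    have e1 : η i k 0 = (Φ + η) i k 0 - Φ i k 0 := by simp
    show |η i k 0| ≤ 2 * max M 0
    rw [e1]
    calc |(Φ + η) i k 0 - Φ i k 0| ≤ |(Φ + η) i k 0| + |Φ i k 0| := abs_sub _ _
      _ ≤ 2 * max M 0 := by linarith
  obtain ⟨v, hv0, hvd, hvb⟩ := exists_linearised_solution shiftSetFlat (mirrorTable ε ε) hWb' hM0 hΛt hlipW hd0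
  have hvbT : ∀ i n, ∀ t ∈ Icc 0 τ,
      |v i n t| ≤ 2 * max M 0 * Real.exp (2 * tableAbsSum shiftSetFlat (mirrorTable ε ε) * max M 0 * τ) :=
    fun i n t ht => hvb τ hτ i n t ⟨by linarith [ht.1], ht.2⟩
  have hv0' : ∀ i n, v i n 0 = η i n 0 := fun i n => hv0 i n
  -- the anchored contraction applied to v
  obtain ⟨c₁, hc₁, -, hcontr⟩ := hbody v B ⟨hvd, ⟨_, hvbT⟩⟩ (fun i k => by rw [hv0]; exact hB i k)
  -- the remainder η − v at time τ, every site, in the gauge ω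
  have herr : ∀ i n, geomGauge g b i n * |η i n τ - v i n τ| ≤ Rem := fun i n => by
    have h := gauge_linearisation_error_forced₂ isNearestNeighbourSet_shiftSetFlat (mirrorTable ε ε) hw hA hω hωw
      hΦ hηc hΦb hXηb hfc hfb hF hfω hFω hηd hvd hvbT hv0' hB' hτ i n (s := τ) ⟨hτ, le_rfl⟩
    rw [hRem]; exact h
  have hRem0 : 0 ≤ Rem := le_trans (mul_nonneg (hωpos i₀ 1).le (abs_nonneg _)) (herr i₀ 1)
  -- the anchor residual of the remainder
  have hζa : geomGauge g b i₀ 0 * |η i₀ 1 τ - v i₀ 1 τ| ≤ Rem := by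
    have hmono : geomGauge g b i₀ 0 ≤ geomGauge g b i₀ (0 + 1) := geomGauge_le_succ hg hb i₀ 0
    rw [zero_add] at hmono
    exact (mul_le_mul_of_nonneg_right hmono (abs_nonneg _)).trans (herr i₀ 1)
  have hdiff := anchorCoeff_sub ε τ Φ i₀ η v c₁
  have hΦ0 : 0 < |Φ i₀ 1 τ| := abs_pos.mpr hΦa
  have hB0 : 0 ≤ B := le_trans (mul_nonneg (hωpos i₀ 0).le (abs_nonneg _)) (hB i₀ 0)
  refine ⟨c₁, hc₁, fun i k => ?_⟩
  by_cases hik : i = i₀ ∧ k = 0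
  · -- the anchor coordinate: the corrected deviation vanishes
    obtain ⟨rfl, rfl⟩ := hik
    have h0 := anchorCoeff_spec (ε := ε) hΦa η c₁
    have : η i (0 + 1) τ - c₁ * quadTermOn shiftSetFlat 0 (mirrorTable ε ε) Φ i (0 + 1) τ
        - anchorCoeff ε τ Φ i η c₁ * Φ i (0 + 1) τ = 0 := by simpa using h0
    rw [this, abs_zero, mul_zero]
    positivity
  · have hp := hprof i k hik
    have hωk : 0 ≤ geomGauge g b i k := (hωpos i k).le
    -- decomposition of the corrected deviation
    have e1 : η i (k + 1) τ - c₁ * quadTermOn shiftSetFlat 0 (mirrorTable ε ε) Φ i (k + 1) τ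
          - anchorCoeff ε τ Φ i₀ η c₁ * Φ i (k + 1) τ
        = (v i (k + 1) τ - c₁ * quadTermOn shiftSetFlat 0 (mirrorTable ε ε) Φ i (k + 1) τ
            - anchorCoeff ε τ Φ i₀ v c₁ * Φ i (k + 1) τ)
          + (η i (k + 1) τ - v i (k + 1) τ)
          - (anchorCoeff ε τ Φ i₀ η c₁ - anchorCoeff ε τ Φ i₀ v c₁) * Φ i (k + 1) τ := by ring
    -- the three pieces
    have p1 := hcontr i k
    have p2 : geomGauge g b i k * |η i (k + 1) τ - v i (k + 1) τ| ≤ Rem :=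
      (mul_le_mul_of_nonneg_right (geomGauge_le_succ hg hb i k) (abs_nonneg _)).trans (herr i (k + 1))
    have p3 : geomGauge g b i k * |(anchorCoeff ε τ Φ i₀ η c₁ - anchorCoeff ε τ Φ i₀ v c₁) * Φ i (k + 1) τ|
        ≤ q * Rem := by
      rw [hdiff, abs_mul, abs_div]
      calc geomGauge g b i k * (|η i₀ 1 τ - v i₀ 1 τ| / |Φ i₀ 1 τ| * |Φ i (k + 1) τ|)
          = |η i₀ 1 τ - v i₀ 1 τ| / |Φ i₀ 1 τ| * (geomGauge g b i k * |Φ i (k + 1) τ|) := by ring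
        _ ≤ |η i₀ 1 τ - v i₀ 1 τ| / |Φ i₀ 1 τ| * (q * (geomGauge g b i₀ 0 * |Φ i₀ 1 τ|)) :=
            mul_le_mul_of_nonneg_left hp (div_nonneg (abs_nonneg _) hΦ0.le)
        _ = q * (geomGauge g b i₀ 0 * |η i₀ 1 τ - v i₀ 1 τ|) := by field_simp
        _ ≤ q * Rem := mul_le_mul_of_nonneg_left hζa hq
    rw [e1]
    calc geomGauge g b i k * |(v i (k + 1) τ - c₁ * quadTermOn shiftSetFlat 0 (mirrorTable ε ε) Φ i (k + 1) τ
              - anchorCoeff ε τ Φ i₀ v c₁ * Φ i (k + 1) τ)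
            + (η i (k + 1) τ - v i (k + 1) τ)
            - (anchorCoeff ε τ Φ i₀ η c₁ - anchorCoeff ε τ Φ i₀ v c₁) * Φ i (k + 1) τ|
        ≤ geomGauge g b i k * (|v i (k + 1) τ - c₁ * quadTermOn shiftSetFlat 0 (mirrorTable ε ε) Φ i (k + 1) τ
              - anchorCoeff ε τ Φ i₀ v c₁ * Φ i (k + 1) τ|
            + |η i (k + 1) τ - v i (k + 1) τ|
            + |(anchorCoeff ε τ Φ i₀ η c₁ - anchorCoeff ε τ Φ i₀ v c₁) * Φ i (k + 1) τ|) :=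
          mul_le_mul_of_nonneg_left (abs_sub_le_of_three _ _ _) hωk
      _ ≤ ρ * B + Rem + q * Rem := by nlinarith [p1, p2, p3]
      _ = ρ * B + (1 + q) * Rem := by ring
where
  /-- `|a + b − c| ≤ |a| + |b| + |c|`. -/
  abs_sub_le_of_three (a b c : ℝ) : |a + b - c| ≤ |a| + |b| + |c| :=
    (abs_sub _ _).trans (by linarith [abs_add_le a b])

end MirrorPulse

end Summit.NavierStokesRegularity.NavierStokesRegularity.Theorems

end
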